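import Mathlib.Tactic
import HarnessLib

/-!
# The Rhin–Viola exponents `H, K, α, β, δ` of a parameter tuple `(h, j, k, l, m)` and their bookkeeping

Topic `Literature/NumberTheory/DiophantineApproximation`. DEFINITIONS (`bigH`, `bigK`, `alpha`, `beta`, `delta`)
with proved API; no named facts. Source: G. Rhin, C. Viola, *The permutation group method for the dilogarithm*,
Ann. Sc. Norm. Super. Pisa Cl. Sci. (5) 4 (2005) 389–437, (2.9):

  `H = max{l+m−j, m+h−k, h+j−l, j+k−m}`,  `K = max{l+m−j, min{m+h−k, h+j−l}, j+k−m}`,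
  `α = max{j+k, k+l, l+m}`,  `β = max{0, k+l−h}`,  `δ = max{h, m+h−k, h+j−l, j+k, k+l, l+m}`,

the integers governing Theorem 2.1 (`d_H d_K z^α (z−1)^β I_z(h,j,k,l,m) = P(z) − Q(z) Li₂(1/z)`, …,
`deg ≤ δ`), together with

* **Lemma 2.8 in invariant form**: `δ = α + β + h − k − l` (as integers) — equivalent to the four printed
  cases (`β = k+l−h ⇒ δ = α`; `β = 0, α = j+k ⇒ δ = h+j−l`; `β = 0, α = k+l ⇒ δ = h`; `β = 0, α = l+m ⇒
  δ = m+h−k`), cf. Viola–Zudilin's remark (2.4) "`δ₁ − α₁ − β₁ = h − k − l` in any case";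
* the **bookkeeping inequalities** (2.31), (2.43) and their `λ`-conjugates used in the inductive proof of
  Theorem 2.1 (pp. 406–409): along each linear decomposition (2.29), (2.29)', (2.41), (2.41)' the
  children `q` satisfy `H_q ≤ H`, `K_q ≤ K`, `α_q ≤ α + s_q`, `β_q ≤ β + t_q` and
  `(α + s_q − α_q) + (β + t_q − β_q) + δ_q ≤ δ`, where `z^{s_q}(z−1)^{t_q}` is the coefficient of the child
  (`s_q ∈ {0,−1}`, `t_q ∈ {0,1}`).

Design note (truncated subtraction). The entries are written with natural-number subtraction. This does
not change any of the five values: `(l+m−j) + (j+k−m) = k+l ≥ 0`, so at least one of `l+m−j`, `j+k−m` is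
`≥ 0` and `H, K ≥ 0` as printed; replacing a negative entry of a `max` whose value is `≥ 0` by `0` leaves the
`max` unchanged (for the `min` inside `K`: if it is negative it does not contribute, and its truncation `0`
does not either); `β` is `max{0,·}` verbatim and `α`, `δ ≥ h ≥ 0` likewise.

## References

* G. Rhin, C. Viola, Ann. Sc. Norm. Super. Pisa Cl. Sci. (5) 4 (2005) 389–437, (2.9), Lemma 2.8, (2.31),
  (2.43). [RhinViola2005]
* C. Viola, W. Zudilin, *Linear independence of dilogarithmic values*, J. reine angew. Math. 736 (2018)
  193–223, (2.4). [ViolaZudilin2018]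
-/

namespace Literature.NumberTheory.DiophantineApproximation

namespace RhinViola

/-- `H = max{l+m−j, m+h−k, h+j−l, j+k−m}` (Rhin–Viola (2.9)). [cite: RhinViola2005, (2.9)] -/
def bigH (h j k l m : ℕ) : ℕ := max (max (l + m - j) (m + h - k)) (max (h + j - l) (j + k - m))

/-- `K = max{l+m−j, min{m+h−k, h+j−l}, j+k−m}` (Rhin–Viola (2.9)). [cite: RhinViola2005, (2.9)] -/
def bigK (h j k l m : ℕ) : ℕ := max (max (l + m - j) (min (m + h - k) (h + j - l))) (j + k - m)

/-- `α = max{j+k, k+l, l+m}` (Rhin–Viola (2.9); independent of `h`). [cite: RhinViola2005, (2.9)] -/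
def alpha (_h j k l m : ℕ) : ℕ := max (max (j + k) (k + l)) (l + m)

/-- `β = max{0, k+l−h}` (Rhin–Viola (2.9); independent of `j, m`). [cite: RhinViola2005, (2.9)] -/
def beta (h _j k l _m : ℕ) : ℕ := k + l - h

/-- `δ = max{h, m+h−k, h+j−l, j+k, k+l, l+m}` (Rhin–Viola (2.9)). [cite: RhinViola2005, (2.9)] -/
def delta (h j k l m : ℕ) : ℕ := max (max (max h (m + h - k)) (max (h + j - l) (j + k))) (max (k + l) (l + m))

/-! ### Unfolding lemmas -/

/-- Unfolding `H`. [cite: RhinViola2005, (2.9)] -/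
theorem bigH_def (h j k l m : ℕ) :
    bigH h j k l m = max (max (l + m - j) (m + h - k)) (max (h + j - l) (j + k - m)) := rfl

/-- Unfolding `K`. [cite: RhinViola2005, (2.9)] -/
theorem bigK_def (h j k l m : ℕ) :
    bigK h j k l m = max (max (l + m - j) (min (m + h - k) (h + j - l))) (j + k - m) := rfl

/-- Unfolding `α`. [cite: RhinViola2005, (2.9)] -/
theorem alpha_def (h j k l m : ℕ) : alpha h j k l m = max (max (j + k) (k + l)) (l + m) := rfl

/-- Unfolding `β`. [cite: RhinViola2005, (2.9)] -/
theorem beta_def (h j k l m : ℕ) : beta h j k l m = k + l - h := rfl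

/-- Unfolding `δ`. [cite: RhinViola2005, (2.9)] -/
theorem delta_def (h j k l m : ℕ) :
    delta h j k l m = max (max (max h (m + h - k)) (max (h + j - l) (j + k))) (max (k + l) (l + m)) := rfl

/-- All five exponents vanish at the origin `(0,0,0,0,0)` (Lemma 2.3's case). [cite: RhinViola2005, Lemma 2.3] -/
theorem exponents_zero :
    bigH 0 0 0 0 0 = 0 ∧ bigK 0 0 0 0 0 = 0 ∧ alpha 0 0 0 0 0 = 0 ∧ beta 0 0 0 0 0 = 0 ∧ delta 0 0 0 0 0 = 0 := by
  simp [bigH, bigK, alpha, beta, delta]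

/-- `K ≤ H`. [cite: RhinViola2005, (2.9)] -/
theorem bigK_le_bigH (h j k l m : ℕ) : bigK h j k l m ≤ bigH h j k l m := by
  unfold bigK bigH
  exact max_le_max (max_le_max le_rfl (min_le_left _ _)) (le_max_right _ _)

/-- Memberwise monotonicity of `H`. [folklore] -/
theorem bigH_mono {h j k l m h' j' k' l' m' : ℕ} (h₁ : l + m - j ≤ l' + m' - j') (h₂ : m + h - k ≤ m' + h' - k')
    (h₃ : h + j - l ≤ h' + j' - l') (h₄ : j + k - m ≤ j' + k' - m') : bigH h j k l m ≤ bigH h' j' k' l' m' := by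
  unfold bigH
  exact max_le_max (max_le_max h₁ h₂) (max_le_max h₃ h₄)

/-- Memberwise monotonicity of `K`. [folklore] -/
theorem bigK_mono {h j k l m h' j' k' l' m' : ℕ} (h₁ : l + m - j ≤ l' + m' - j') (h₂ : m + h - k ≤ m' + h' - k')
    (h₃ : h + j - l ≤ h' + j' - l') (h₄ : j + k - m ≤ j' + k' - m') : bigK h j k l m ≤ bigK h' j' k' l' m' := by
  unfold bigK
  exact max_le_max (max_le_max h₁ (min_le_min h₂ h₃)) h₄

/-- `l + m ≤ α`, so that `z^α · z^{−l−m}` is a monomial. [cite: RhinViola2005, (2.9)] -/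
theorem add_le_alpha (h j k l m : ℕ) : l + m ≤ alpha h j k l m := by
  unfold alpha; omega

/-- `α ≤ n` iff each member is `≤ n`. [folklore] -/
theorem alpha_le_iff (h j k l m n : ℕ) : alpha h j k l m ≤ n ↔ j + k ≤ n ∧ k + l ≤ n ∧ l + m ≤ n := by
  simp [alpha]

/-- `α` is one of its members. [folklore] -/
theorem alpha_cases (h j k l m : ℕ) :
    alpha h j k l m = j + k ∨ alpha h j k l m = k + l ∨ alpha h j k l m = l + m := by
  unfold alpha
  rcases max_choice (max (j + k) (k + l)) (l + m) with e | e <;> rw [e]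
  · rcases max_choice (j + k) (k + l) with e | e <;> rw [e] <;> simp
  · simp

/-- `δ ≤ n` iff each member is `≤ n`. [folklore] -/
theorem delta_le_iff (h j k l m n : ℕ) : delta h j k l m ≤ n ↔
    h ≤ n ∧ m + h - k ≤ n ∧ h + j - l ≤ n ∧ j + k ≤ n ∧ k + l ≤ n ∧ l + m ≤ n := by
  simp [delta]

/-- `δ` is one of its members. [folklore] -/
theorem delta_cases (h j k l m : ℕ) :
    delta h j k l m = h ∨ delta h j k l m = m + h - k ∨ delta h j k l m = h + j - l ∨
      delta h j k l m = j + k ∨ delta h j k l m = k + l ∨ delta h j k l m = l + m := by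
  unfold delta
  rcases max_choice (max (max h (m + h - k)) (max (h + j - l) (j + k))) (max (k + l) (l + m)) with e | e <;>
    rw [e]
  · rcases max_choice (max h (m + h - k)) (max (h + j - l) (j + k)) with e | e <;> rw [e]
    · rcases max_choice h (m + h - k) with e | e <;> rw [e] <;> simp
    · rcases max_choice (h + j - l) (j + k) with e | e <;> rw [e] <;> simp
  · rcases max_choice (k + l) (l + m) with e | e <;> rw [e] <;> simp

/-! ### Lemma 2.8 -/

/-- **Rhin–Viola 2005, Lemma 2.8, invariant form**: `δ = α + β + h − k − l` as integers.
[cite: RhinViola2005, Lemma 2.8; ViolaZudilin2018, (2.4)] -/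
theorem delta_eq (h j k l m : ℕ) :
    (delta h j k l m : ℤ) = alpha h j k l m + beta h j k l m + h - k - l := by
  have hd := (delta_le_iff h j k l m _).1 le_rfl
  have hdc := delta_cases h j k l m
  have ha := (alpha_le_iff h j k l m _).1 le_rfl
  have hac := alpha_cases h j k l m
  unfold beta
  omega

/-- The same in natural numbers (`α ≥ k + l`, so no truncation occurs). [cite: RhinViola2005, Lemma 2.8] -/
theorem delta_eq_nat (h j k l m : ℕ) :
    delta h j k l m = alpha h j k l m + beta h j k l m + h - k - l := by
  have := delta_eq h j k l m
  have ha := (alpha_le_iff h j k l m _).1 le_rfl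
  omega

/-- **Invariance under `λ = (jm)(kl)`** of the five exponents. [cite: RhinViola2005, (2.9)] -/
theorem exponents_lam (h j k l m : ℕ) :
    bigH h m l k j = bigH h j k l m ∧ bigK h m l k j = bigK h j k l m ∧ alpha h m l k j = alpha h j k l m ∧
      beta h m l k j = beta h j k l m ∧ delta h m l k j = delta h j k l m := by
  have ea : alpha h m l k j = alpha h j k l m := by unfold alpha; omega
  have eb : beta h m l k j = beta h j k l m := by unfold beta; omega
  have e1 : k + j - m = j + k - m := by omega
  have e2 : j + h - l = h + j - l := by omega
  have e3 : h + m - k = m + h - k := by omega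
  have e4 : m + l - j = l + m - j := by omega
  refine ⟨?_, ?_, ea, eb, ?_⟩
  · show max (max (k + j - m) (j + h - l)) (max (h + m - k) (m + l - j)) =
      max (max (l + m - j) (m + h - k)) (max (h + j - l) (j + k - m))
    rw [e1, e2, e3, e4, max_comm (max (j + k - m) (h + j - l)), max_comm (j + k - m), max_comm (m + h - k)]
  · show max (max (k + j - m) (min (j + h - l) (h + m - k))) (m + l - j) =
      max (max (l + m - j) (min (m + h - k) (h + j - l))) (j + k - m)
    rw [e1, e2, e3, e4, min_comm (h + j - l), max_comm (max (j + k - m) _) (l + m - j), max_comm (j + k - m),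
      ← max_assoc]
  · have d1 := delta_eq h m l k j
    have d2 := delta_eq h j k l m
    omega

/-- Lemma 2.8 as printed, first case: `β = k+l−h` (i.e. `h ≤ k+l`) implies `δ = α`. [cite: RhinViola2005, Lemma 2.8] -/
theorem delta_eq_alpha_of_le {h j k l m : ℕ} (hh : h ≤ k + l) : delta h j k l m = alpha h j k l m := by
  have := delta_eq_nat h j k l m
  unfold beta at this
  omega

/-- Lemma 2.8 as printed, cases `β = 0` (i.e. `k+l ≤ h`): `δ = max{h, m+h−k, h+j−l}`, whence `δ = h+j−l` if
`α = j+k`, `δ = h` if `α = k+l`, `δ = m+h−k` if `α = l+m`. [cite: RhinViola2005, Lemma 2.8] -/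
theorem delta_eq_of_le {h j k l m : ℕ} (hh : k + l ≤ h) :
    delta h j k l m = max (max h (m + h - k)) (h + j - l) := by
  have := delta_eq_nat h j k l m
  have ha := (alpha_le_iff h j k l m _).1 le_rfl
  have hac := alpha_cases h j k l m
  unfold beta at this
  omega

/-! ### Bookkeeping along the four linear decompositions

Indices are shifted as in the tree's decomposition lemmas: the PARENT tuple is written with the successors. -/

/-- **(2.31)** for (2.29): parent `(h,j,k+1,l,m+1)`, children `(h,j,k,l,m)` (coefficient `z^{−1}`) and
`(h,j,k,l+1,m)` (coefficient `−1`). [cite: RhinViola2005, (2.31) and (2.36)–(2.40)] -/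
theorem bookkeeping_km (h j k l m : ℕ) :
    bigH h j k l m ≤ bigH h j (k + 1) l (m + 1) ∧ bigK h j k l m ≤ bigK h j (k + 1) l (m + 1) ∧
    bigH h j k (l + 1) m ≤ bigH h j (k + 1) l (m + 1) ∧ bigK h j k (l + 1) m ≤ bigK h j (k + 1) l (m + 1) ∧
    alpha h j k l m + 1 ≤ alpha h j (k + 1) l (m + 1) ∧ beta h j k l m ≤ beta h j (k + 1) l (m + 1) ∧
    alpha h j k (l + 1) m ≤ alpha h j (k + 1) l (m + 1) ∧ beta h j k (l + 1) m ≤ beta h j (k + 1) l (m + 1) ∧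
    (alpha h j (k + 1) l (m + 1) - 1 - alpha h j k l m) + (beta h j (k + 1) l (m + 1) - beta h j k l m)
        + delta h j k l m ≤ delta h j (k + 1) l (m + 1) ∧
    (alpha h j (k + 1) l (m + 1) - alpha h j k (l + 1) m) + (beta h j (k + 1) l (m + 1) - beta h j k (l + 1) m)
        + delta h j k (l + 1) m ≤ delta h j (k + 1) l (m + 1) := by
  have a1 : alpha h j k l m + 1 ≤ alpha h j (k + 1) l (m + 1) := by unfold alpha; omega
  have b1 : beta h j k l m ≤ beta h j (k + 1) l (m + 1) := by unfold beta; omega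
  have a2 : alpha h j k (l + 1) m ≤ alpha h j (k + 1) l (m + 1) := by unfold alpha; omega
  have b2 : beta h j k (l + 1) m ≤ beta h j (k + 1) l (m + 1) := by unfold beta; omega
  have dP := delta_eq h j (k + 1) l (m + 1)
  have d1 := delta_eq h j k l m
  have d2 := delta_eq h j k (l + 1) m
  refine ⟨?_, ?_, ?_, ?_, a1, b1, a2, b2, by omega, by omega⟩
  · exact bigH_mono (by omega) (by omega) (by omega) (by omega)
  · exact bigK_mono (by omega) (by omega) (by omega) (by omega)
  · exact bigH_mono (by omega) (by omega) (by omega) (by omega)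
  · exact bigK_mono (by omega) (by omega) (by omega) (by omega)

/-- **(2.31)'** for (2.29)' (the `λ`-conjugate): parent `(h,j+1,k,l+1,m)`, children `(h,j,k,l,m)` (coefficient
`z^{−1}`) and `(h,j,k+1,l,m)` (coefficient `−1`). [cite: RhinViola2005, (2.31) and p. 408] -/
theorem bookkeeping_jl (h j k l m : ℕ) :
    bigH h j k l m ≤ bigH h (j + 1) k (l + 1) m ∧ bigK h j k l m ≤ bigK h (j + 1) k (l + 1) m ∧
    bigH h j (k + 1) l m ≤ bigH h (j + 1) k (l + 1) m ∧ bigK h j (k + 1) l m ≤ bigK h (j + 1) k (l + 1) m ∧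
    alpha h j k l m + 1 ≤ alpha h (j + 1) k (l + 1) m ∧ beta h j k l m ≤ beta h (j + 1) k (l + 1) m ∧
    alpha h j (k + 1) l m ≤ alpha h (j + 1) k (l + 1) m ∧ beta h j (k + 1) l m ≤ beta h (j + 1) k (l + 1) m ∧
    (alpha h (j + 1) k (l + 1) m - 1 - alpha h j k l m) + (beta h (j + 1) k (l + 1) m - beta h j k l m)
        + delta h j k l m ≤ delta h (j + 1) k (l + 1) m ∧
    (alpha h (j + 1) k (l + 1) m - alpha h j (k + 1) l m) + (beta h (j + 1) k (l + 1) m - beta h j (k + 1) l m)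
        + delta h j (k + 1) l m ≤ delta h (j + 1) k (l + 1) m := by
  have a1 : alpha h j k l m + 1 ≤ alpha h (j + 1) k (l + 1) m := by unfold alpha; omega
  have b1 : beta h j k l m ≤ beta h (j + 1) k (l + 1) m := by unfold beta; omega
  have a2 : alpha h j (k + 1) l m ≤ alpha h (j + 1) k (l + 1) m := by unfold alpha; omega
  have b2 : beta h j (k + 1) l m ≤ beta h (j + 1) k (l + 1) m := by unfold beta; omega
  have dP := delta_eq h (j + 1) k (l + 1) m
  have d1 := delta_eq h j k l m
  have d2 := delta_eq h j (k + 1) l m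
  refine ⟨?_, ?_, ?_, ?_, a1, b1, a2, b2, by omega, by omega⟩
  · exact bigH_mono (by omega) (by omega) (by omega) (by omega)
  · exact bigK_mono (by omega) (by omega) (by omega) (by omega)
  · exact bigH_mono (by omega) (by omega) (by omega) (by omega)
  · exact bigK_mono (by omega) (by omega) (by omega) (by omega)

/-- **(2.43)** for (2.41): parent `(h+1,j,k,l+1,m)`, children `(h,j,k,l,m)` (coefficient `1`), `(h,j,k,l+1,m)`
(coefficient `−(z−1)`) and `(h,j,k,l,m+1)` (coefficient `−1`). [cite: RhinViola2005, (2.43)–(2.45)] -/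
theorem bookkeeping_hl (h j k l m : ℕ) :
    bigH h j k l m ≤ bigH (h + 1) j k (l + 1) m ∧ bigK h j k l m ≤ bigK (h + 1) j k (l + 1) m ∧
    bigH h j k (l + 1) m ≤ bigH (h + 1) j k (l + 1) m ∧ bigK h j k (l + 1) m ≤ bigK (h + 1) j k (l + 1) m ∧
    bigH h j k l (m + 1) ≤ bigH (h + 1) j k (l + 1) m ∧ bigK h j k l (m + 1) ≤ bigK (h + 1) j k (l + 1) m ∧
    alpha h j k l m ≤ alpha (h + 1) j k (l + 1) m ∧ beta h j k l m ≤ beta (h + 1) j k (l + 1) m ∧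
    alpha h j k (l + 1) m ≤ alpha (h + 1) j k (l + 1) m ∧ beta h j k (l + 1) m ≤ beta (h + 1) j k (l + 1) m + 1 ∧
    alpha h j k l (m + 1) ≤ alpha (h + 1) j k (l + 1) m ∧ beta h j k l (m + 1) ≤ beta (h + 1) j k (l + 1) m ∧
    (alpha (h + 1) j k (l + 1) m - alpha h j k l m) + (beta (h + 1) j k (l + 1) m - beta h j k l m)
        + delta h j k l m ≤ delta (h + 1) j k (l + 1) m ∧
    (alpha (h + 1) j k (l + 1) m - alpha h j k (l + 1) m) + (beta (h + 1) j k (l + 1) m + 1 - beta h j k (l + 1) m)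
        + delta h j k (l + 1) m ≤ delta (h + 1) j k (l + 1) m ∧
    (alpha (h + 1) j k (l + 1) m - alpha h j k l (m + 1)) + (beta (h + 1) j k (l + 1) m - beta h j k l (m + 1))
        + delta h j k l (m + 1) ≤ delta (h + 1) j k (l + 1) m := by
  have a3 : alpha h j k l m ≤ alpha (h + 1) j k (l + 1) m := by unfold alpha; omega
  have b3 : beta h j k l m ≤ beta (h + 1) j k (l + 1) m := by unfold beta; omega
  have a4 : alpha h j k (l + 1) m ≤ alpha (h + 1) j k (l + 1) m := by unfold alpha; omega
  have b4 : beta h j k (l + 1) m ≤ beta (h + 1) j k (l + 1) m + 1 := by unfold beta; omega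
  have a5 : alpha h j k l (m + 1) ≤ alpha (h + 1) j k (l + 1) m := by unfold alpha; omega
  have b5 : beta h j k l (m + 1) ≤ beta (h + 1) j k (l + 1) m := by unfold beta; omega
  have dP := delta_eq (h + 1) j k (l + 1) m
  have d3 := delta_eq h j k l m
  have d4 := delta_eq h j k (l + 1) m
  have d5 := delta_eq h j k l (m + 1)
  refine ⟨?_, ?_, ?_, ?_, ?_, ?_, a3, b3, a4, b4, a5, b5, by omega, by omega, by omega⟩
  · exact bigH_mono (by omega) (by omega) (by omega) (by omega)
  · exact bigK_mono (by omega) (by omega) (by omega) (by omega)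
  · exact bigH_mono (by omega) (by omega) (by omega) (by omega)
  · exact bigK_mono (by omega) (by omega) (by omega) (by omega)
  · exact bigH_mono (by omega) (by omega) (by omega) (by omega)
  · exact bigK_mono (by omega) (by omega) (by omega) (by omega)

/-- **(2.43)'** for (2.41)' (the `λ`-conjugate): parent `(h+1,j,k+1,l,m)`, children `(h,j,k,l,m)` (coefficient
`1`), `(h,j,k+1,l,m)` (coefficient `−(z−1)`) and `(h,j+1,k,l,m)` (coefficient `−1`).
[cite: RhinViola2005, (2.43) and p. 409] -/
theorem bookkeeping_hk (h j k l m : ℕ) :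
    bigH h j k l m ≤ bigH (h + 1) j (k + 1) l m ∧ bigK h j k l m ≤ bigK (h + 1) j (k + 1) l m ∧
    bigH h j (k + 1) l m ≤ bigH (h + 1) j (k + 1) l m ∧ bigK h j (k + 1) l m ≤ bigK (h + 1) j (k + 1) l m ∧
    bigH h (j + 1) k l m ≤ bigH (h + 1) j (k + 1) l m ∧ bigK h (j + 1) k l m ≤ bigK (h + 1) j (k + 1) l m ∧
    alpha h j k l m ≤ alpha (h + 1) j (k + 1) l m ∧ beta h j k l m ≤ beta (h + 1) j (k + 1) l m ∧
    alpha h j (k + 1) l m ≤ alpha (h + 1) j (k + 1) l m ∧ beta h j (k + 1) l m ≤ beta (h + 1) j (k + 1) l m + 1 ∧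
    alpha h (j + 1) k l m ≤ alpha (h + 1) j (k + 1) l m ∧ beta h (j + 1) k l m ≤ beta (h + 1) j (k + 1) l m ∧
    (alpha (h + 1) j (k + 1) l m - alpha h j k l m) + (beta (h + 1) j (k + 1) l m - beta h j k l m)
        + delta h j k l m ≤ delta (h + 1) j (k + 1) l m ∧
    (alpha (h + 1) j (k + 1) l m - alpha h j (k + 1) l m) + (beta (h + 1) j (k + 1) l m + 1 - beta h j (k + 1) l m)
        + delta h j (k + 1) l m ≤ delta (h + 1) j (k + 1) l m ∧
    (alpha (h + 1) j (k + 1) l m - alpha h (j + 1) k l m) + (beta (h + 1) j (k + 1) l m - beta h (j + 1) k l m)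
        + delta h (j + 1) k l m ≤ delta (h + 1) j (k + 1) l m := by
  have a3 : alpha h j k l m ≤ alpha (h + 1) j (k + 1) l m := by unfold alpha; omega
  have b3 : beta h j k l m ≤ beta (h + 1) j (k + 1) l m := by unfold beta; omega
  have a4 : alpha h j (k + 1) l m ≤ alpha (h + 1) j (k + 1) l m := by unfold alpha; omega
  have b4 : beta h j (k + 1) l m ≤ beta (h + 1) j (k + 1) l m + 1 := by unfold beta; omega
  have a5 : alpha h (j + 1) k l m ≤ alpha (h + 1) j (k + 1) l m := by unfold alpha; omega
  have b5 : beta h (j + 1) k l m ≤ beta (h + 1) j (k + 1) l m := by unfold beta; omega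
  have dP := delta_eq (h + 1) j (k + 1) l m
  have d3 := delta_eq h j k l m
  have d4 := delta_eq h j (k + 1) l m
  have d5 := delta_eq h (j + 1) k l m
  refine ⟨?_, ?_, ?_, ?_, ?_, ?_, a3, b3, a4, b4, a5, b5, by omega, by omega, by omega⟩
  · exact bigH_mono (by omega) (by omega) (by omega) (by omega)
  · exact bigK_mono (by omega) (by omega) (by omega) (by omega)
  · exact bigH_mono (by omega) (by omega) (by omega) (by omega)
  · exact bigK_mono (by omega) (by omega) (by omega) (by omega)
  · exact bigH_mono (by omega) (by omega) (by omega) (by omega)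
  · exact bigK_mono (by omega) (by omega) (by omega) (by omega)

/-! ### The exponents in the base cases -/

/-- Lemma 2.2's case `j + k < m`: `H' := max{l+m−j, m+h−k} ≤ H`, `K' := min{l+m−j, m+h−k} ≤ K`, `α = l+m`.
[cite: RhinViola2005, Lemma 2.2 (proof)] -/
theorem exponents_of_lt {h j k l m : ℕ} (hm : j + k < m) :
    max (l + m - j) (m + h - k) ≤ bigH h j k l m ∧ min (l + m - j) (m + h - k) ≤ bigK h j k l m ∧
      alpha h j k l m = l + m := by
  refine ⟨?_, ?_, ?_⟩
  · unfold bigH; exact le_max_left _ _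
  · unfold bigK
    exact le_trans (by omega) (le_max_left _ _)
  · unfold alpha; omega

/-- Lemma 2.4/2.6's tuple `(0,0,k,l,0)`: `H = K = max{k,l}`, `α = β = δ = k+l`. [cite: RhinViola2005, Lemma 2.6 (proof)] -/
theorem exponents_zero_zero_k_l_zero (k l : ℕ) :
    bigH 0 0 k l 0 = max k l ∧ bigK 0 0 k l 0 = max k l ∧ alpha 0 0 k l 0 = k + l ∧ beta 0 0 k l 0 = k + l ∧
      delta 0 0 k l 0 = k + l := by
  have ea : alpha 0 0 k l 0 = k + l := by unfold alpha; omega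
  have eb : beta 0 0 k l 0 = k + l := by unfold beta; omega
  refine ⟨?_, ?_, ea, eb, ?_⟩
  · unfold bigH; omega
  · unfold bigK; omega
  · have := delta_eq_nat 0 0 k l 0; omega

/-- Lemma 2.7's tuple `(h,j,0,0,j)`: `H = K = δ = h+j`, `α = j`, `β = 0`. [cite: RhinViola2005, Lemma 2.7 (proof)] -/
theorem exponents_h_j_zero_zero_j (h j : ℕ) :
    bigH h j 0 0 j = h + j ∧ bigK h j 0 0 j = h + j ∧ alpha h j 0 0 j = j ∧ beta h j 0 0 j = 0 ∧
      delta h j 0 0 j = h + j := by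
  have ea : alpha h j 0 0 j = j := by unfold alpha; omega
  have eb : beta h j 0 0 j = 0 := by unfold beta; omega
  refine ⟨?_, ?_, ea, eb, ?_⟩
  · unfold bigH; omega
  · unfold bigK; omega
  · have := delta_eq_nat h j 0 0 j; omega

end RhinViola

end Literature.NumberTheory.DiophantineApproximation
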